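import Summits.ValiantsHypothesis.ValiantsHypothesis.Theses.ChowBorderDepth3
import Summits.ValiantsHypothesis.ValiantsHypothesis.Theses.SummationBits
import Summits.ValiantsHypothesis.ValiantsHypothesis.Theses.Depth4
import Literature.Computability.AlgebraicComplexity.DepthThreeChasm
import Literature.Computability.AlgebraicComplexity.HomogeneousCircuits

/-!
# Strategy census for crux `Depth3Thesis` (item stmt-ValiantsHypothesis-5934) — typed companions

Crux-strategist unit `cstrat-stmt-ValiantsHypothesis-5934-s2` (route ChowBorderDepth3; decl shared
with route SummationBits). This file types the statements named in `STRATEGY-CENSUS.md`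
(`## Transfer`, `## Strengthen`, `## Decomposition`, `## Negation`) over existing declarations, so
that every census entry is a checkable `Prop` and the two elementary bridges are kernel-checked.
Nothing here is a registered line: no `stub_*`, no claim on the lead's skeleton (`Lines/birth.lean`).

Conventions: the (r, D, ℓ) "affine ΣΠΣ expression" currency of both routes
(`SPSNormalForm`): `per_n = ∑_{i<r} ∏_{j<D} ℓ i j`, `ℓ i j` affine (total degree ≤ 1); the chasm
threshold `T_c(n) = (n+2)^(c⌊√n⌋+c)`.
-/

set_option linter.dupNamespace false

namespace Summit.ValiantsHypothesis.ValiantsHypothesis.Cruxes.Depth3Thesis.Strategist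

open Literature.Computability.AlgebraicComplexity

/-- An affine ΣΠΣ expression of `per_n` over a commutative ring `R` with `r` summands of `D`
affine factors each (the routes' normal-form currency, over an arbitrary coefficient ring so that
finite-field shadows can be stated). [folklore] -/
def IsAffineSPS (R : Type*) [CommRing R] (n r D : ℕ)
    (ℓ : Fin r → Fin D → MvPolynomial (Fin n × Fin n) R) : Prop :=
  (∀ i j, (ℓ i j).totalDegree ≤ 1) ∧ (∑ i, ∏ j, ℓ i j) = perPoly (Fin n) R

/-! ## Transfer -/

/-- TRANSFER T1 (finite-field sibling, Grigoriev–Karpinski 1998 / Grigoriev–Razborov 2000), the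
UNIFORM-in-the-field form that would transfer: for every `c`, eventually in `n`, every affine ΣΠΣ
expression of `per_n` over EVERY finite field of characteristic `≠ 2` has more than `T_c(n)`
"wires" `r·(D+1)`. GK98 prove `N ≥ γ_q^n` for `det_n` over a FIXED `𝔽_q` with `γ_q → 1`
(rank threshold `y₀·q·n`, §1), which is void once `q ≥ n`; the uniform statement is FALSE for
`det` (GKKS chasm circuits over `ℚ` reduce mod almost every `p`), so a proof must be
per-specific and must work at `q > D`, where degree-`D` interpolation is available exactly as over
`ℂ`. Implies the crux via `AlgebraicConstants` + `FiniteFieldShadow` (`depth3Thesis_of_uniformFiniteField`).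
[cite: doi:10.1145/276698.276872, Thm. and §1] -/
def UniformFiniteFieldDepth3 : Prop :=
  ∀ c : ℕ, ∃ n₀ : ℕ, ∀ n ≥ n₀, ∀ (F : Type) [Field F] [Fintype F], ringChar F ≠ 2 →
    ∀ (r D : ℕ) (ℓ : Fin r → Fin D → MvPolynomial (Fin n × Fin n) F),
      IsAffineSPS F n r D ℓ → (n + 2) ^ (c * Nat.sqrt n + c) < r * (D + 1)

/-- DECOMPOSITION piece D2 (provable in principle: `per_n` has rational coefficients, the
expressions with fixed `(n, r, D)` form a `ℚ`-variety, and a `ℂ`-point gives a `ℚ̄`-point by the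
weak Nullstellensatz over the algebraically closed field `ℚ̄ ⊂ ℂ`): WLOG all coefficients of all
affine forms are algebraic numbers. [folklore] -/
def AlgebraicConstants : Prop :=
  ∀ (n r D : ℕ), (∃ ℓ : Fin r → Fin D → MvPolynomial (Fin n × Fin n) ℂ, IsAffineSPS ℂ n r D ℓ) →
    ∃ ℓ : Fin r → Fin D → MvPolynomial (Fin n × Fin n) ℂ, IsAffineSPS ℂ n r D ℓ ∧
      ∀ i j m, IsAlgebraic ℚ ((ℓ i j).coeff m)

/-- DECOMPOSITION piece D3 (provable in principle: the finitely many algebraic constants lie in a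
number field `K` and are integral at all but finitely many primes of `K`; reduce the identity
modulo such a prime of residue characteristic `p > N`): an algebraic-coefficient expression has a
shadow with the SAME `(r, D)` over some finite field of arbitrarily large characteristic. The
norm `q` of that prime is NOT controlled from above — this is where the transfer breaks. [folklore] -/
def FiniteFieldShadow : Prop :=
  ∀ (n r D : ℕ), (∃ ℓ : Fin r → Fin D → MvPolynomial (Fin n × Fin n) ℂ, IsAffineSPS ℂ n r D ℓ ∧
      ∀ i j m, IsAlgebraic ℚ ((ℓ i j).coeff m)) →
    ∀ N : ℕ, ∃ (p : ℕ) (F : Type) (_ : Field F) (_ : Fintype F), N < p ∧ ringChar F = p ∧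
      ∃ ℓ' : Fin r → Fin D → MvPolynomial (Fin n × Fin n) F, IsAffineSPS F n r D ℓ'

/-- `9 · T_c(n)² ≤ T_{2c+2}(n)` for `n ≥ 1` (threshold arithmetic, as in `Lines/birth.lean`). -/
theorem threshold_nine_sq_le (n c : ℕ) (hn : 1 ≤ n) :
    9 * ((n + 2) ^ (c * Nat.sqrt n + c)) ^ 2 ≤
      (n + 2) ^ ((2 * c + 2) * Nat.sqrt n + (2 * c + 2)) := by
  calc 9 * ((n + 2) ^ (c * Nat.sqrt n + c)) ^ 2
      ≤ (n + 2) ^ (2 * Nat.sqrt n + 2) * ((n + 2) ^ (c * Nat.sqrt n + c)) ^ 2 := by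
        apply Nat.mul_le_mul_right
        calc 9 = 3 ^ 2 := by norm_num
          _ ≤ (n + 2) ^ 2 := Nat.pow_le_pow_left (by omega) 2
          _ ≤ (n + 2) ^ (2 * Nat.sqrt n + 2) := Nat.pow_le_pow_right (by omega) (by omega)
    _ = (n + 2) ^ ((2 * c + 2) * Nat.sqrt n + (2 * c + 2)) := by
        rw [← pow_mul, ← pow_add]; congr 1; ring

/-- The arithmetic split at ONE size `n ≥ 1` (exponent `2c+2` in the finite-field bound, as the
bookkeeping through `SPSNormalForm` squares the wire count). -/
theorem uniform_compose_at {n c : ℕ} (hn : 1 ≤ n) (hA : AlgebraicConstants) (hS : FiniteFieldShadow)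
    (hUn : ∀ (F : Type) [Field F] [Fintype F], ringChar F ≠ 2 →
      ∀ (r D : ℕ) (ℓ : Fin r → Fin D → MvPolynomial (Fin n × Fin n) F),
        IsAffineSPS F n r D ℓ → (n + 2) ^ ((2 * c + 2) * Nat.sqrt n + (2 * c + 2)) < r * (D + 1))
    (P : ArithCircuit ℂ (Fin n × Fin n)) (hP : P.Computes (perPoly (Fin n) ℂ))
    (hd : P.productDepth ≤ 1) :
    (n + 2) ^ (c * Nat.sqrt n + c) < P.edgeSize := by
  have hNF := Summit.ValiantsHypothesis.ValiantsHypothesis.Theses.SummationBits.SPSNormalForm_holds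
  unfold Summit.ValiantsHypothesis.ValiantsHypothesis.Theses.SummationBits.SPSNormalForm at hNF
  obtain ⟨ℓ, hℓ, hsum⟩ := hNF n P hP hd
  -- ℂ-expression ⇒ algebraic-coefficient expression ⇒ finite-field shadow of odd characteristic
  obtain ⟨ℓa, hℓa, halg⟩ := hA n (P.edgeSize + 1) (P.edgeSize + 1) ⟨ℓ, hℓ, hsum⟩
  obtain ⟨p, F, instF, instFin, hp2, hchar, ℓ', hℓ'⟩ :=
    hS n (P.edgeSize + 1) (P.edgeSize + 1) ⟨ℓa, hℓa, halg⟩ 2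
  have hchar2 : ringChar F ≠ 2 := by rw [hchar]; omega
  have h1 := hUn F hchar2 (P.edgeSize + 1) (P.edgeSize + 1) ℓ' hℓ'
  -- threshold arithmetic: T_{2c+2} < (E+1)(E+2) forces T_c < E
  by_contra hlt
  set T : ℕ := (n + 2) ^ (c * Nat.sqrt n + c) with hT
  have hE : P.edgeSize ≤ T := not_lt.mp hlt
  have hT1 : 1 ≤ T := Nat.one_le_pow _ _ (by omega)
  have h9 := threshold_nine_sq_le n c hn
  rw [← hT] at h9
  have hsq : (P.edgeSize + 1) * (P.edgeSize + 1 + 1) ≤ 9 * T ^ 2 := by nlinarith [hE, hT1]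
  have : (P.edgeSize + 1) * (P.edgeSize + 1 + 1) < (P.edgeSize + 1) * (P.edgeSize + 1 + 1) :=
    calc (P.edgeSize + 1) * (P.edgeSize + 1 + 1) ≤ 9 * T ^ 2 := hsq
      _ ≤ (n + 2) ^ ((2 * c + 2) * Nat.sqrt n + (2 * c + 2)) := h9
      _ < (P.edgeSize + 1) * (P.edgeSize + 1 + 1) := h1
  exact lt_irrefl _ this

/-- The ARITHMETIC SPLIT composes (kernel-checked): algebraic constants + finite-field shadow +
the uniform finite-field bound give the crux, through the PROVED normal form `SPSNormalForm`.
The third hypothesis is the piece that "remains the whole crux" (it is stronger than the crux).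
[cite: doi:10.1145/276698.276872, §1 (open problem: characteristic zero)] -/
theorem depth3Thesis_of_uniformFiniteField (hA : AlgebraicConstants) (hS : FiniteFieldShadow)
    (hU : UniformFiniteFieldDepth3) :
    Summit.ValiantsHypothesis.ValiantsHypothesis.Theses.ChowBorderDepth3.Depth3Thesis := by
  intro c
  obtain ⟨n₀, hn₀⟩ := hU (2 * c + 2)
  exact ⟨n₀ + 1, fun P hP hd => uniform_compose_at (n := n₀ + 1) (c := c) (by omega) hA hS
    (fun F _ _ hF r D ℓ h => hn₀ (n₀ + 1) (by omega) F hF r D ℓ h) P hP hd⟩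

/-- TRANSFER T2 (homogeneous sibling; Limaye–Srinivasan–Tavenas 2025 Lemma 10 = GKKS 2016 Lemma
5.6, after Shpilka–Wigderson 2001 Thm 5.3), specialised to the permanent: a ΣΠΣ circuit with `E`
wires computing `per_n` yields a HOMOGENEOUS circuit of product-depth `≤ 2` (a `ΣΠΣΠΣ` / `ΣΠ(Σ∧Σ)`
circuit, the tree's `homProductDepthCircuitSize 2`) with `poly(E)·2^{O(√n)}` gates. With it the
Depth4 route's support item `Depth4Homogeneous` implies the crux (threshold bookkeeping only), i.e.
the crux is the WEAKEST of {`Depth4Thesis`, `Depth4Homogeneous`, `Depth3Thesis`}; the transfer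
removes the interpolation regime but lands one product layer up, where even `n^{Ω(√n)}` for
`per_n` is open (`Depth4HomFourSqrt`). Vendorable named fact; not in the tree yet.
[cite: doi:10.1109/focs52979.2021.00083, Lemma 10] -/
def LSTHomogenisation : Prop :=
  ∃ K : ℕ, ∀ (n : ℕ) (P : ArithCircuit ℂ (Fin n × Fin n)),
    P.Computes (perPoly (Fin n) ℂ) → P.productDepth ≤ 1 →
      homProductDepthCircuitSize 2 (perPoly (Fin n) ℂ) ≤
        ((P.edgeSize + 2 : ℕ∞) ^ K * (2 : ℕ∞) ^ (K * Nat.sqrt n + K))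

/-! ## Strengthen -/

/-- STRENGTHEN S2 (functional form, Forbes–Kumar–Saptharishi 2016): count wires of ΣΠΣ circuits
that merely AGREE with `per_n` on 0/1 matrices (number of perfect matchings). Strictly stronger
(`depth3Thesis_of_functional`); automatically separates `per` from `det` (different functions),
but functional lower bounds for even modest depth-4 models imply Boolean separations
(`#P ⊄ ACC⁰`-type, FKS16 Lemma 1.x), so the added rigidity (sub-cube restrictions, matchings
self-reducibility) is paid for with a Boolean-frontier barrier. [cite: arXiv:1605.04207, §1.1] -/
def FunctionalDepth3 : Prop :=
  ∀ c : ℕ, ∃ n : ℕ, ∀ P : ArithCircuit ℂ (Fin n × Fin n), P.productDepth ≤ 1 →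
    (∀ x : Fin n × Fin n → ℂ, (∀ v, x v = 0 ∨ x v = 1) →
        MvPolynomial.eval x P.eval = MvPolynomial.eval x (perPoly (Fin n) ℂ)) →
      (n + 2) ^ (c * Nat.sqrt n + c) < P.edgeSize

/-- The functional form implies the crux (syntactic computation is functional computation).
[cite: arXiv:1605.04207, Obs. 1.3] -/
theorem depth3Thesis_of_functional (h : FunctionalDepth3) :
    Summit.ValiantsHypothesis.ValiantsHypothesis.Theses.ChowBorderDepth3.Depth3Thesis := by
  intro c
  obtain ⟨n, hn⟩ := h c
  refine ⟨n, fun P hP hd => hn P hd (fun x _ => ?_)⟩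
  unfold ArithCircuit.Computes at hP
  rw [hP]

/-- STRENGTHEN S4 (multiplicativity / direct product — the form that would make induction on `n`
work): ΣΠΣ wire counts of tensor powers `per_2^{⊗k} = ∏_{b<k} per_2(X_b)` (a restriction of
`per_{2k}` to block-diagonal support) grow like `2^k`. FALSE: see `TensorSubmultiplicative`. -/
def TensorMultiplicative : Prop :=
  ∀ (k r D : ℕ) (ℓ : Fin r → Fin D → MvPolynomial (Fin k × (Fin 2 × Fin 2)) ℂ),
    (∀ i j, (ℓ i j).totalDegree ≤ 1) →
      (∑ i, ∏ j, ℓ i j) = ∏ b : Fin k, MvPolynomial.rename (fun v => (b, v)) (perPoly (Fin 2) ℂ) →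
        2 ^ k ≤ r * (D + 1)

/-- The refutation of S4, a consequence of the vendored depth-3 chasm
(`sigmaPiSigma_edgeSize_le_of_complexity`, Tavenas 2015 Cor. 1 / GKKS 2016 Thm 1.1) applied to the
trivial formula `∏_b per_2(X_b)` (`4k` variables, degree `2k`, complexity `O(k)`): tensor powers
of `per_2` have affine ΣΠΣ expressions with `(k+2)^{O(√k)} ≪ 2^k` wires. ΣΠΣ complexity is
therefore wildly sub-multiplicative under `⊗`, unconditionally — the depth-reduction phenomenon
itself; no direct-product route to the crux exists. [cite: Tavenas2015, Cor. 1] -/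
def TensorSubmultiplicative : Prop :=
  ∃ K : ℕ, ∀ k : ℕ, ∃ (r D : ℕ) (ℓ : Fin r → Fin D → MvPolynomial (Fin k × (Fin 2 × Fin 2)) ℂ),
    (∀ i j, (ℓ i j).totalDegree ≤ 1) ∧
      (∑ i, ∏ j, ℓ i j) = ∏ b : Fin k, MvPolynomial.rename (fun v => (b, v)) (perPoly (Fin 2) ℂ) ∧
        r * (D + 1) ≤ (k + 2) ^ (K * Nat.sqrt k + K)

/-! ## Decomposition (rungs that are NOT the crux, for the record) -/

/-- DECOMPOSITION D4 / weaker rung (Shpilka 2002 symmetric model, `d = n`): `per_n = e_n(L₁,…,L_m)`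
with affine `L_j` forces `m(m+1) > T_c(n)`. A CONSEQUENCE of the crux (Ben-Or interpolation,
Shpilka 2002 Thm 3.1: such a representation is a ΣΠΣ expression with `r = m+1`, `D = m`), not a
route to it (the model is weaker: `s_sym(f) ≥ √(s₃(f)) − 1`, ibid. Thm 3.2, and conjecturally
exponentially weaker, Conj. 3.1); its own frontier is `m ≥ n²`-type (ibid. Thm 1.1 / Lemma 4.1).
Recorded to show the interpolation regime is open already for ONE symmetric gate.
[cite: doi:10.1016/s0022-0000(02)00021-1, Thm 3.1, Thm 3.2, Lemma 4.1] -/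
def SymmetricRung : Prop :=
  ∀ c : ℕ, ∃ n₀ : ℕ, ∀ n ≥ n₀, ∀ (m : ℕ) (L : Fin m → MvPolynomial (Fin n × Fin n) ℂ),
    (∀ j, (L j).totalDegree ≤ 1) →
      ((Finset.univ : Finset (Fin m)).val.map L).esymm n = perPoly (Fin n) ℂ →
        (n + 2) ^ (c * Nat.sqrt n + c) < (m + 1) * (m + 1)

/-- DECOMPOSITION D5 / conjectural floor (top fan-in of EXACT expressions): `r ≥ n`. Would follow
from "no affine subspace of codimension `< n` lies on the permanental hypersurface" (the
Dieudonné–Flanders statement for `det`; for `per` over `ℂ` not located in print by this seat) via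
`per_n ≡ 0` on `⋂_i {ℓ_{i,j(i)} = 0}`. Orthogonal to the crux (wires, not summands). -/
def TopFanInFloor : Prop :=
  ∀ n : ℕ, 2 ≤ n → ∀ (r D : ℕ) (ℓ : Fin r → Fin D → MvPolynomial (Fin n × Fin n) ℂ),
    IsAffineSPS ℂ n r D ℓ → n ≤ r

/-! ## Negation -/

/-- NEGATION: the counterexample family that `¬ Depth3Thesis` asserts — one exponent `c` and, for
EVERY `n`, a ΣΠΣ circuit for `per_n` with at most `T_c(n) = 2^{O(√n log n)}` wires (a
sub-exponential permanent ALGORITHM in the non-uniform algebraic model; cf. Ryser/Glynn `n·2^n`,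
and `2^{Ω(n)}` for 0/1 permanents under #ETH, Dell–Husfeldt–Marx–Taslaman–Wahlén 2014).
[cite: doi:10.1145/2635812, Thm 1.x] -/
def CounterexampleFamily : Prop :=
  ∃ c : ℕ, ∀ n : ℕ, ∃ P : ArithCircuit ℂ (Fin n × Fin n),
    P.Computes (perPoly (Fin n) ℂ) ∧ P.productDepth ≤ 1 ∧ P.edgeSize ≤ (n + 2) ^ (c * Nat.sqrt n + c)

/-- `CounterexampleFamily` is literally the negation of the crux. -/
theorem counterexampleFamily_iff_not_depth3Thesis :
    CounterexampleFamily ↔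
      ¬ Summit.ValiantsHypothesis.ValiantsHypothesis.Theses.ChowBorderDepth3.Depth3Thesis := by
  unfold CounterexampleFamily Summit.ValiantsHypothesis.ValiantsHypothesis.Theses.ChowBorderDepth3.Depth3Thesis
  push Not
  rfl

end Summit.ValiantsHypothesis.ValiantsHypothesis.Cruxes.Depth3Thesis.Strategist
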